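import Literature.NumberTheory.Li1992.RallisLocalFactorSplitUnramified
import Literature.NumberTheory.Li1992.RallisLocalFactorUnramifiedNonsplit
import Literature.Analysis.Complex.HolomorphicProducts
import Literature.NumberTheory.LFunctions.NumberFieldDirichletDensity
import Literature.NumberTheory.Automorphic.AdicCompletionResidueCard
import Mathlib.Analysis.Complex.Exponential
import Mathlib.Analysis.Normed.Group.InfiniteSum
import HarnessLib

/-!
# [Li1992, Thm 2.1 (27)] — ABSOLUTE CONVERGENCE of the Euler product of the local factors: the per-place bookkeeping

J.-S. Li, *Non-vanishing theorems for the cohomology of certain arithmetic quotients*, J. reine angew. Math. **428** (1992),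
Thm 2.1 p. 184: for factorizable data the right-hand side of Rallis' inner product formula (26) is the EULER PRODUCT (27)
`∏_v I_v`, `I_v = ∫_{G'_v} ⟨ω_v(h)φ_v, φ_v⟩ χ̄_v(h) dh_v`, "absolutely convergent" in the stable range (p. 184, proof of Thm 2.1:
at almost every place the factor is the unramified one, computed in §5 p. 206).  For the rank-one member `G' = U(J₁)` of the
pair `(U(J), U(J₁))`, `dim J = N`, the unramified factor at a NON-SPLIT place is `1` (normalised measures; ★
`RallisLocalFactorUnramifiedNonsplit`) and at a SPLIT place it is the Tate-type sum `(1 − r_v²) ∕ |1 − α_v r_v|²`,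
`r_v = q_v^{-N/2}`, `|α_v| = 1` (★ `RallisLocalFactorSplitUnramified`); so `I_v = 1 + O(q_v^{-N/2})` and likewise for the
integral of the ABSOLUTE VALUE of the local integrand, `(1 + r_v) ∕ (1 − r_v) = 1 + O(q_v^{-N/2})` — which is what the
restricted-product (Tate) exchange of `∫` and `∏` needs ([TateThesis1967, Thm 3.3.1]: bounded partial products of `∫ |f_v|`).
THIS FILE is that bookkeeping, kernel only:

* §1 (`Literature.NumberTheory.Li1992`) the real algebra of the split factor: `|(1 − r²)/‖1 − α r‖² − 1| ≤ 12 r` and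
  `Σ_{m∈ℤ} r^{|m|} = (1 + r)/(1 − r) ≤ 1 + 4 r` for `|α| = 1`, `0 ≤ r ≤ 1/2`;
* §2 the exponent: `q_v = N(v)`, `(√(q^N))⁻¹ = q^{-N/2} ≤ 1/2` (`q ≥ 2`, `N ≥ 2`), `Σ_v N(v)^{-N/2} < ∞` for `N ≥ 3`
  (★ `LFunctions.NumberField.summable_absNorm_rpow_neg`);
* §3 ABSTRACT Euler-product bookkeeping over any index type: eventual bounds `A_v ≤ 1 + a_v` with `Σ a_v < ∞` give ONE bound
  for every finite partial product `∏_{v∈S} A_v` (the hypothesis `hB` of the tree's restricted-product exchange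
  `HodgeCM.PerL34.…integral_eq_tprod`), and `‖I_v − 1‖ ≤ a_v` eventually with every `I_v ≠ 0` gives `∏' v, I_v` convergent
  and NON-ZERO (★ `Analysis.Complex.tprod_ne_zero_of_summable_norm_sub_one`, [Conway1978, VII.5.9]);
* §4 (`…FinLocalSplittings`) the integral of the NORM of the local integrand of (27) at the spherical data: at a split
  unramified place `∫ |f_v| dh = dh(U(J₁)(𝒪_v)) · |C| · (1 + r)/(1 − r)` (same hypotheses as ★
  `integral_localFactor_unitVec_of_sphericalCoeff`), and at a place where the torus fixes `1_{𝒪ᴺ}` and `χ_v ≡ 1`,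
  `∫ |f_v| dh = dh(U(J₁)(F_v)) · μ_X(𝒪_vᴺ)`.

The `∀ᶠ v` assembly of these into the bounds `‖I_v − K_v C_v‖ ≤ 12 K_v C_v N(v)^{-N/2}`, `∫|f_v| ≤ K_v C_v (1 + 4 N(v)^{-N/2})`
for a restricted family of local splittings is the sequel `RallisLocalFactorEulerBoundsAssembly.lean`.
KERNEL only: theorems, no definition, no named fact, no `sorry`.  Cell hodgecm-mathlib, FLOOR 0, programme P4 (F3′), crux item
H413 (`--supports stmt-HodgeConjecture-24833`).  HC_CM is proved only modulo the printed citations until rung 0 closes; nothing here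
is a claim about them.

## References
* [Li1992] J.-S. Li, J. reine angew. Math. 428 (1992) 177–217 — Thm 2.1 (26)–(27) p. 184; §5 p. 206.
* [TateThesis1967] J. Tate, in Cassels–Fröhlich, *Algebraic Number Theory* (1967), Ch. XV §3.2, Thm 3.3.1, §4.2.
* [Conway1978] J. B. Conway, *Functions of One Complex Variable* (1978), VII.5 Thm 5.9.
-/

set_option autoImplicit false

noncomputable section

open NumberField IsDedekindDomain MeasureTheory Filter Set
open scoped Matrix NNReal Topology ComplexConjugate
open Literature.RepresentationTheory Literature.RepresentationTheory.HeisenbergGroup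
open Literature.NumberTheory.Automorphic
open Literature.NumberTheory.Automorphic.UnitaryGroup
open Literature.NumberTheory.Automorphic.Liu2021
open Literature.NumberTheory.Weil1964

namespace Literature.NumberTheory.Li1992

/-! ## §1 The real algebra of the split unramified factor `(1 − r²) ∕ |1 − α r|²` and of `Σ_m r^{|m|}` -/

section Algebra

/-- `1 − r ≤ |1 − α r|` for `|α| = 1`, `0 ≤ r`. [cite: TateThesis1967, §4.2] -/
theorem one_sub_le_norm_one_sub_mul {α : ℂ} (hα : ‖α‖ = 1) {r : ℝ} (hr0 : 0 ≤ r) :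
    1 - r ≤ ‖1 - α * r‖ := by
  have h : ‖α * (r : ℂ)‖ = r := by
    rw [norm_mul, hα, one_mul, Complex.norm_real, Real.norm_eq_abs, abs_of_nonneg hr0]
  calc 1 - r = ‖(1 : ℂ)‖ - ‖α * (r : ℂ)‖ := by rw [norm_one, h]
    _ ≤ ‖1 - α * r‖ := norm_sub_norm_le 1 (α * r)

/-- `|1 − α r|² = 1 − 2 Re(α) r + r²` for `|α| = 1`. [cite: TateThesis1967, §4.2] -/
theorem norm_one_sub_mul_sq {α : ℂ} (hα : ‖α‖ = 1) (r : ℝ) :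
    ‖1 - α * (r : ℂ)‖ ^ 2 = 1 - 2 * α.re * r + r ^ 2 := by
  have hα2 : α.re ^ 2 + α.im ^ 2 = 1 := by
    have := Complex.sq_norm α
    rw [hα, one_pow, Complex.normSq_apply] at this
    nlinarith [this]
  rw [Complex.sq_norm, Complex.normSq_apply]
  simp only [Complex.sub_re, Complex.one_re, Complex.mul_re, Complex.ofReal_re, Complex.ofReal_im, mul_zero,
    sub_zero, Complex.sub_im, Complex.one_im, Complex.mul_im, zero_sub]
  nlinarith [hα2]

/-- **`|(1 − r²) ∕ |1 − α r|² − 1| ≤ 12 r`** for `|α| = 1`, `0 ≤ r ≤ 1/2`: the split unramified local factor of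
[Li1992, (27)] (value `(1 − r²)/|1 − α r|²`, `r = q_v^{-N/2}`, ★ `hasSum_int_geometric_unit`) is `1 + O(q_v^{-N/2})`
(`(1 − r²)/D − 1 = 2r(Re α − r)/D`, `D ≥ (1 − r)² ≥ 1/4`). [cite: Li1992, Thm 2.1 (27) p. 184; §5 p. 206] -/
theorem abs_int_geometric_unit_sub_one_le {α : ℂ} (hα : ‖α‖ = 1) {r : ℝ} (hr0 : 0 ≤ r) (hr2 : r ≤ 1 / 2) :
    |(1 - r ^ 2) / ‖1 - α * (r : ℂ)‖ ^ 2 - 1| ≤ 12 * r := by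
  have hD : 1 / 2 ≤ ‖1 - α * (r : ℂ)‖ := le_trans (by linarith) (one_sub_le_norm_one_sub_mul hα hr0)
  have hD2 : 1 / 4 ≤ ‖1 - α * (r : ℂ)‖ ^ 2 := by nlinarith
  have hpos : 0 < ‖1 - α * (r : ℂ)‖ ^ 2 := by linarith
  have hre : |α.re| ≤ 1 := hα ▸ Complex.abs_re_le_norm α
  have hre1 : α.re ≤ 1 := (abs_le.1 hre).2
  have hre2 : -1 ≤ α.re := (abs_le.1 hre).1
  rw [div_sub_one hpos.ne', abs_div, abs_of_pos hpos, div_le_iff₀ hpos, norm_one_sub_mul_sq hα r]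
  rw [norm_one_sub_mul_sq hα r] at hD2
  refine abs_le.2 ⟨?_, ?_⟩
  · nlinarith [mul_nonneg hr0 hr0, mul_le_mul_of_nonneg_left hre1 hr0]
  · nlinarith [mul_nonneg hr0 hr0, mul_le_mul_of_nonneg_left hre2 hr0]

/-- **`Σ_{m∈ℤ} r^{|m|} = (1 + r) ∕ (1 − r)`** for `0 ≤ r < 1` (the two geometric series; the value of
★ `hasSum_int_geometric_unit` at `w = 1`): the integral of the ABSOLUTE VALUE of the split unramified local integrand
of [Li1992, (27)] is `vol · |C| · Σ_m r^{|m|}`. [cite: TateThesis1967, §4.2] -/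
theorem hasSum_pow_natAbs {r : ℝ} (hr0 : 0 ≤ r) (hr1 : r < 1) :
    HasSum (fun m : ℤ => r ^ m.natAbs) ((1 + r) / (1 - r)) := by
  have h₁ : HasSum (fun n : ℕ => r ^ (n : ℤ).natAbs) (1 - r)⁻¹ := by
    refine (hasSum_geometric_of_lt_one hr0 hr1).congr_fun fun n => ?_
    rw [Int.natAbs_natCast]
  have h₂ : HasSum (fun n : ℕ => r ^ (-(n + 1 : ℤ)).natAbs) (r * (1 - r)⁻¹) := by
    refine ((hasSum_geometric_of_lt_one hr0 hr1).mul_left r).congr_fun fun n => ?_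
    rw [show (-(n + 1 : ℤ)).natAbs = n + 1 by omega, pow_succ']
  have h := HasSum.of_nat_of_neg_add_one (f := fun m : ℤ => r ^ m.natAbs) h₁ h₂
  have hval : (1 - r)⁻¹ + r * (1 - r)⁻¹ = (1 + r) / (1 - r) := by
    have hne : (1 - r) ≠ 0 := by linarith
    field_simp
  rwa [hval] at h

/-- `(1 + r) ∕ (1 − r) ≤ 1 + 4 r` for `0 ≤ r ≤ 1/2`. [cite: TateThesis1967, §4.2] -/
theorem one_add_div_one_sub_le {r : ℝ} (hr0 : 0 ≤ r) (hr2 : r ≤ 1 / 2) : (1 + r) / (1 - r) ≤ 1 + 4 * r := by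
  have hpos : 0 < 1 - r := by linarith
  rw [div_le_iff₀ hpos]
  nlinarith

/-- `1 ≤ (1 + r) ∕ (1 − r)` for `0 ≤ r < 1`. [cite: TateThesis1967, §4.2] -/
theorem one_le_one_add_div_one_sub {r : ℝ} (hr0 : 0 ≤ r) (hr1 : r < 1) : 1 ≤ (1 + r) / (1 - r) := by
  have hpos : 0 < 1 - r := by linarith
  rw [le_div_iff₀ hpos]
  linarith

end Algebra

/-! ## §2 The exponent: `q_v = N(v)`, `r_v = (√(q_v^N))⁻¹ = N(v)^{-N/2} ≤ 1/2`, `Σ_v N(v)^{-N/2} < ∞` for `N ≥ 3` -/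

section Exponent

variable (F : Type) [Field F] [NumberField F]

/-- **`q_v = N(v)`**: the residue-field cardinality of the local field `F_v` (the `residueFieldCard` of the tree's local files)
is the absolute norm of the prime `v`. [cite: TateThesis1967, §4.1] -/
theorem residueFieldCard_adicCompletion_eq_absNorm (v : HeightOneSpectrum (𝓞 F)) :
    GaloisRepresentations.IsNonarchimedeanLocalField.residueFieldCard (v.adicCompletion F) = Ideal.absNorm v.asIdeal := by
  rw [residueFieldCard_adicCompletion_eq, HeightOneSpectrum.residueCard_eq_card_quotient, Ideal.absNorm_apply,
    Submodule.cardQuot_apply]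

/-- `2 ≤ q_v` as a real number. [cite: TateThesis1967, §4.1] -/
theorem two_le_residueFieldCard_adicCompletion (v : HeightOneSpectrum (𝓞 F)) :
    (2 : ℝ) ≤ (GaloisRepresentations.IsNonarchimedeanLocalField.residueFieldCard (v.adicCompletion F) : ℝ) := by
  have h := GaloisRepresentations.IsNonarchimedeanLocalField.one_lt_residueFieldCard (v.adicCompletion F)
  exact_mod_cast h

/-- `(√(q^N))⁻¹ = q^{-N/2}` for `q ≥ 0` (the spherical-coefficient ratio `r_v` of ★ `FinLocalSplittingsSplitSphericalCoeffDarboux`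
as a real power). [cite: Li1992, §5 p. 206] -/
theorem inv_sqrt_pow_eq_rpow {q : ℝ} (hq : 0 ≤ q) (N : ℕ) : (Real.sqrt (q ^ N))⁻¹ = q ^ (-((N : ℝ) / 2)) := by
  rw [Real.sqrt_eq_rpow, ← Real.rpow_natCast, ← Real.rpow_mul hq, Real.rpow_neg hq]
  congr 1
  ring_nf

/-- `0 ≤ (√(q^N))⁻¹ < 1` for `q > 1`, `N ≠ 0`. [cite: Li1992, §5 p. 206] -/
theorem inv_sqrt_pow_nonneg_lt_one {q : ℝ} (hq : 1 < q) {N : ℕ} (hN : N ≠ 0) :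
    0 ≤ (Real.sqrt (q ^ N))⁻¹ ∧ (Real.sqrt (q ^ N))⁻¹ < 1 := by
  refine ⟨inv_nonneg.2 (Real.sqrt_nonneg _), inv_lt_one_of_one_lt₀ ?_⟩
  rw [Real.lt_sqrt zero_le_one, one_pow]
  exact one_lt_pow₀ hq hN

/-- `(√(q^N))⁻¹ ≤ 1/2` for `q ≥ 2`, `N ≥ 2`. [cite: Li1992, §5 p. 206] -/
theorem inv_sqrt_pow_le_half {q : ℝ} (hq : 2 ≤ q) {N : ℕ} (hN : 2 ≤ N) : (Real.sqrt (q ^ N))⁻¹ ≤ 1 / 2 := by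
  have h4 : (4 : ℝ) ≤ q ^ N := by
    calc (4 : ℝ) = 2 ^ 2 := by norm_num
      _ ≤ q ^ 2 := pow_le_pow_left₀ (by norm_num) hq 2
      _ ≤ q ^ N := pow_le_pow_right₀ (by linarith) hN
  have h2 : (2 : ℝ) ≤ Real.sqrt (q ^ N) := by
    rw [show (2 : ℝ) = Real.sqrt 4 by rw [show (4 : ℝ) = 2 ^ 2 by norm_num, Real.sqrt_sq (by norm_num)]]
    exact Real.sqrt_le_sqrt h4
  rw [one_div]
  exact inv_anti₀ (by norm_num) h2

/-- **`Σ_v N(v)^{-N/2} < ∞` for `N ≥ 3`** (the Dedekind zeta function of `F` converges at `N/2 > 1`; ★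
`LFunctions.NumberField.summable_absNorm_rpow_neg`): the majorant of `|I_v − 1|` in [Li1992, (27)] for the pair
`(U(J), U(J₁))`, `dim J = N ≥ 3`, is summable over the finite places. [cite: Li1992, Thm 2.1 (27) p. 184] -/
theorem summable_absNorm_rpow_neg_half_of_three_le {N : ℕ} (hN : 3 ≤ N) :
    Summable fun v : HeightOneSpectrum (𝓞 F) => (Ideal.absNorm v.asIdeal : ℝ) ^ (-((N : ℝ) / 2)) := by
  have h : (1 : ℝ) < (N : ℝ) / 2 := by
    have : (3 : ℝ) ≤ N := by exact_mod_cast hN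
    linarith
  exact LFunctions.NumberField.summable_absNorm_rpow_neg (K := F) h

end Exponent

/-! ## §3 Abstract Euler-product bookkeeping: bounded partial products and a non-zero `∏'` from eventual bounds -/

section EulerProduct

/-- **ONE bound for every finite partial product `∏_{v ∈ S} A_v`** from `0 ≤ A_v`, `A_v ≤ 1 + a_v` off a finite set and
`Σ_v a_v < ∞`: `∏_{v∈S} A_v ≤ (∏_{v ∈ T₁} max(A_v, 1)) · exp(Σ' a)` (`1 + a ≤ eᵃ`) — the hypothesis «bounded partial products
of `∫ |f_v|`» of the restricted-product exchange [TateThesis1967, Thm 3.3.1] for the Euler product [Li1992, (27)].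
[cite: TateThesis1967, Thm 3.3.1] [cite: Li1992, Thm 2.1 (27) p. 184] -/
theorem exists_prod_le_of_eventually_le_one_add {ι : Type*} (A a : ι → ℝ) (hA : ∀ v, 0 ≤ A v) (ha : ∀ v, 0 ≤ a v)
    (hs : Summable a) (hle : ∀ᶠ v in cofinite, A v ≤ 1 + a v) :
    ∃ B : ℝ, ∀ S : Finset ι, ∏ v ∈ S, A v ≤ B := by
  classical
  obtain ⟨T₁, hT₁⟩ : ∃ T₁ : Finset ι, ∀ v ∉ T₁, A v ≤ 1 + a v := by
    rw [Filter.eventually_cofinite] at hle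
    exact ⟨hle.toFinset, fun v hv => not_not.1 fun h' => hv (hle.mem_toFinset.2 h')⟩
  refine ⟨(∏ v ∈ T₁, max (A v) 1) * Real.exp (∑' v, a v), fun S => ?_⟩
  have hsplit : ∏ v ∈ S, A v = (∏ v ∈ S \ T₁, A v) * ∏ v ∈ S ∩ T₁, A v := by
    rw [← Finset.prod_union (Finset.disjoint_sdiff_inter S T₁), Finset.sdiff_union_inter]
  have h1a : ∏ v ∈ S ∩ T₁, A v ≤ ∏ v ∈ S ∩ T₁, max (A v) 1 :=
    Finset.prod_le_prod (fun v _ => hA v) fun v _ => le_max_left _ _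
  have h1b : ∏ v ∈ S ∩ T₁, max (A v) 1 ≤ ∏ v ∈ T₁, max (A v) 1 := by
    rw [← Finset.prod_sdiff (Finset.inter_subset_right : S ∩ T₁ ⊆ T₁)]
    refine le_mul_of_one_le_left (Finset.prod_nonneg fun v _ => le_trans zero_le_one (le_max_right _ _)) ?_
    calc (1 : ℝ) = ∏ _v ∈ T₁ \ (S ∩ T₁), (1 : ℝ) := Finset.prod_const_one.symm
      _ ≤ ∏ v ∈ T₁ \ (S ∩ T₁), max (A v) 1 := Finset.prod_le_prod (fun _ _ => zero_le_one) fun v _ => le_max_right _ _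
  have h2 : ∏ v ∈ S \ T₁, A v ≤ Real.exp (∑' v, a v) := by
    calc ∏ v ∈ S \ T₁, A v ≤ ∏ v ∈ S \ T₁, Real.exp (a v) :=
          Finset.prod_le_prod (fun v _ => hA v) fun v hv =>
            le_trans (hT₁ v (Finset.mem_sdiff.1 hv).2) (by linarith [Real.add_one_le_exp (a v)])
      _ = Real.exp (∑ v ∈ S \ T₁, a v) := (Real.exp_sum _ _).symm
      _ ≤ Real.exp (∑' v, a v) := Real.exp_le_exp.2 (hs.sum_le_tsum _ fun v _ => ha v)
  have h0 : 0 ≤ ∏ v ∈ S \ T₁, A v := Finset.prod_nonneg fun v _ => hA v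
  have h0' : 0 ≤ ∏ v ∈ T₁, max (A v) 1 := Finset.prod_nonneg fun v _ => le_trans zero_le_one (le_max_right _ _)
  rw [hsplit, mul_comm]
  exact mul_le_mul (h1a.trans h1b) h2 h0 h0'

/-- **`Σ_v ‖I_v − 1‖ < ∞`** from `‖I_v − 1‖ ≤ a_v` off a finite set, `Σ a_v < ∞`. [cite: Conway1978, VII.5 Cor. 5.6] -/
theorem summable_norm_sub_one_of_eventually_le {ι : Type*} (I : ι → ℂ) (a : ι → ℝ) (hs : Summable a)
    (hle : ∀ᶠ v in cofinite, ‖I v - 1‖ ≤ a v) : Summable fun v => ‖I v - 1‖ :=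
  Summable.of_norm_bounded_eventually hs (by simpa only [norm_norm] using hle)

/-- **THE EULER PRODUCT CONVERGES AND IS NON-ZERO**: if `‖I_v − 1‖ ≤ a_v` off a finite set with `Σ a_v < ∞` and every factor
`I_v` is non-zero, then `∏' v, I_v` converges (unconditionally) and `∏' v, I_v ≠ 0` — the shape in which [Li1992, Thm 2.1]
concludes `⟨θ_φ(f), θ_φ(f)⟩ ≠ 0` from (26)–(27) once every local factor is made non-zero (§5). [cite: Li1992, Thm 2.1 (26)–(27) p. 184]
[cite: Conway1978, VII.5 Thm 5.9] -/
theorem multipliable_and_tprod_ne_zero_of_eventually_le {ι : Type*} (I : ι → ℂ) (a : ι → ℝ) (hs : Summable a)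
    (hle : ∀ᶠ v in cofinite, ‖I v - 1‖ ≤ a v) (hne : ∀ v, I v ≠ 0) :
    Multipliable I ∧ ∏' v, I v ≠ 0 :=
  ⟨Analysis.Complex.multipliable_of_summable_norm_sub_one (summable_norm_sub_one_of_eventually_le I a hs hle),
    Analysis.Complex.tprod_ne_zero_of_summable_norm_sub_one (summable_norm_sub_one_of_eventually_le I a hs hle) hne⟩

/-- **normalised form**: if `‖I_v − 1‖ ≤ c · a_v` and `A_v ≤ 1 + c' · a_v` off a finite set, `0 ≤ A_v`, `0 ≤ a_v`, `Σ a_v < ∞`, and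
every `I_v ≠ 0`, then the partial products of `A` are bounded AND `∏' I ≠ 0` (both conclusions of this § at once, constants
absorbed). [cite: Li1992, Thm 2.1 (26)–(27) p. 184] [cite: TateThesis1967, Thm 3.3.1] -/
theorem eulerProduct_bookkeeping {ι : Type*} (I : ι → ℂ) (A a : ι → ℝ) (c c' : ℝ) (hA : ∀ v, 0 ≤ A v) (ha : ∀ v, 0 ≤ a v)
    (hc' : 0 ≤ c') (hs : Summable a) (hI : ∀ᶠ v in cofinite, ‖I v - 1‖ ≤ c * a v) (hAle : ∀ᶠ v in cofinite, A v ≤ 1 + c' * a v)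
    (hne : ∀ v, I v ≠ 0) :
    (∃ B : ℝ, ∀ S : Finset ι, ∏ v ∈ S, A v ≤ B) ∧ Multipliable I ∧ ∏' v, I v ≠ 0 :=
  ⟨exists_prod_le_of_eventually_le_one_add A (fun v => c' * a v) hA (fun v => mul_nonneg hc' (ha v)) (hs.mul_left c') hAle,
    multipliable_and_tprod_ne_zero_of_eventually_le I (fun v => c * a v) (hs.mul_left c) hI hne⟩

end EulerProduct

end Literature.NumberTheory.Li1992

/-! ## §4 The integral of the NORM of the local integrand of (27) at the spherical data -/

namespace Literature.NumberTheory.GelbartRogawski1991.UnitaryDualPair.LocalSplitting.FinLocalSplittings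

variable {F : Type} [Field F] [NumberField F] {E : Type} [Field E] [NumberField E] [Algebra F E]
  [Algebra.IsQuadraticExtension F E] {c : E ≃ₐ[F] E} {N : ℕ} {δ : E} {hcδ : c δ = -δ} {hδ : δ ≠ 0} {d : F}
  {hd : δ * δ = algebraMap F E d} {T : Matrix (Fin N) (Fin N) F} {hT : T.IsSymm}
  {J : Matrix (Fin N) (Fin N) E} {hJ : J = T.map (algebraMap F E)}
  (𝓢 : FinLocalSplittings F E c N hcδ hδ hd T hT hJ) (J₁ : Matrix (Fin 1) (Fin 1) E) (hJ₁ : J₁ 0 0 ≠ 0)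
  (v : HeightOneSpectrum (𝓞 F))
  [MeasurableSpace (localPi E c 1 J₁ v)] (dh : Measure (localPi E c 1 J₁ v))
  [MeasurableSpace (Fin N → v.adicCompletion F)] (μX : Measure (Fin N → v.adicCompletion F))
  (χv : localPi E c 1 J₁ v →* ℂˣ)

omit [MeasurableSpace (localPi E c 1 J₁ v)] in
/-- the local integrand of (27) at the spherical vector is RIGHT-INVARIANT under `U(J₁)(𝒪_v)` when the integral torus fixes
`1_{𝒪_vᴺ}` through the centre and `χ_v` is trivial on it. [cite: Li1992, Thm 2.1 (27) p. 184; §5 p. 206] -/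
theorem localFactor_unitVec_mul_of_mem
    (hfix : ∀ k ∈ localInt E c 1 J₁ v, 𝓢.omegaLoc v (localCenter E c N J J₁ hJ₁ v k) (unitVec F (Fin N) v) = unitVec F (Fin N) v)
    (hχK : ∀ k ∈ localInt E c 1 J₁ v, χv k = 1) (h : localPi E c 1 J₁ v) {k : localPi E c 1 J₁ v}
    (hk : k ∈ localInt E c 1 J₁ v) :
    (∫ x, ((𝓢.omegaLoc v (localCenter E c N J J₁ hJ₁ v (h * k)) (unitVec F (Fin N) v) :
          ↥(SchwartzBruhat (Fin N → v.adicCompletion F))) : (Fin N → v.adicCompletion F) → ℂ) x *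
        conj (((unitVec F (Fin N) v : ↥(SchwartzBruhat (Fin N → v.adicCompletion F))) : (Fin N → v.adicCompletion F) → ℂ) x) ∂μX) *
      conj (((χv (h * k) : ℂˣ) : ℂ)) =
    (∫ x, ((𝓢.omegaLoc v (localCenter E c N J J₁ hJ₁ v h) (unitVec F (Fin N) v) :
          ↥(SchwartzBruhat (Fin N → v.adicCompletion F))) : (Fin N → v.adicCompletion F) → ℂ) x *
        conj (((unitVec F (Fin N) v : ↥(SchwartzBruhat (Fin N → v.adicCompletion F))) : (Fin N → v.adicCompletion F) → ℂ) x) ∂μX) *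
      conj (((χv h : ℂˣ) : ℂ)) := by
  simp only [map_mul]
  rw [show (𝓢.omegaLoc v (localCenter E c N J J₁ hJ₁ v h) * 𝓢.omegaLoc v (localCenter E c N J J₁ hJ₁ v k)) (unitVec F (Fin N) v) =
      𝓢.omegaLoc v (localCenter E c N J J₁ hJ₁ v h) (unitVec F (Fin N) v) by rw [Module.End.mul_apply, hfix k hk],
    hχK k hk, mul_one]

/-- **THE INTEGRAL OF THE NORM OF THE SPLIT UNRAMIFIED LOCAL INTEGRAND OF (27).**  Under the hypotheses of ★
`integral_localFactor_unitVec_of_sphericalCoeff` (`U(J₁)(F_v) = ⊔_m z₀^m U(J₁)(𝒪_v)`, `1_{𝒪ᴺ}` fixed by `U(J₁)(𝒪_v)` through the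
centre, `χ_v` trivial there and unitary at `z₀`, spherical matrix coefficients `C u^m r^{|m|}` with `|u| = 1`, `0 ≤ r < 1`):
`∫_{U(J₁)(F_v)} |⟨ω_v(h·1) 1_{𝒪ᴺ}, 1_{𝒪ᴺ}⟩ conj χ_v(h)| dh = dh(U(J₁)(𝒪_v)) · |C| · (1 + r) ∕ (1 − r)` (the Tate-type sum
`vol · Σ_m |C| r^{|m|}`) — the local term of the bounded-partial-products hypothesis of the Euler exchange [TateThesis1967, Thm 3.3.1]
for [Li1992, (27)]. [cite: Li1992, Thm 2.1 (27) p. 184; §5 p. 206] [cite: TateThesis1967, §3.2, Thm 3.3.1] -/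
theorem integral_norm_localFactor_unitVec_of_sphericalCoeff [BorelSpace (localPi E c 1 J₁ v)] [dh.IsMulLeftInvariant]
    [IsFiniteMeasureOnCompacts dh] (z₀ : localPi E c 1 J₁ v)
    (hcover : ∀ h : localPi E c 1 J₁ v, ∃ m : ℤ, (z₀ ^ m)⁻¹ * h ∈ localInt E c 1 J₁ v)
    (hfree : ∀ m : ℤ, z₀ ^ m ∈ localInt E c 1 J₁ v → m = 0)
    (hfix : ∀ k ∈ localInt E c 1 J₁ v, 𝓢.omegaLoc v (localCenter E c N J J₁ hJ₁ v k) (unitVec F (Fin N) v) = unitVec F (Fin N) v)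
    (hχK : ∀ k ∈ localInt E c 1 J₁ v, χv k = 1) (hχu : ‖((χv z₀ : ℂˣ) : ℂ)‖ = 1)
    {C u : ℂ} (hu : ‖u‖ = 1) {r : ℝ} (hr0 : 0 ≤ r) (hr1 : r < 1)
    (hcoef : ∀ m : ℤ, ∫ x, ((𝓢.omegaLoc v (localCenter E c N J J₁ hJ₁ v (z₀ ^ m)) (unitVec F (Fin N) v) :
          ↥(SchwartzBruhat (Fin N → v.adicCompletion F))) : (Fin N → v.adicCompletion F) → ℂ) x *
        conj (((unitVec F (Fin N) v : ↥(SchwartzBruhat (Fin N → v.adicCompletion F))) : (Fin N → v.adicCompletion F) → ℂ) x) ∂μX =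
        C * u ^ m * (r : ℂ) ^ m.natAbs) :
    ∫ h, ‖(∫ x, ((𝓢.omegaLoc v (localCenter E c N J J₁ hJ₁ v h) (unitVec F (Fin N) v) :
            ↥(SchwartzBruhat (Fin N → v.adicCompletion F))) : (Fin N → v.adicCompletion F) → ℂ) x *
          conj (((unitVec F (Fin N) v : ↥(SchwartzBruhat (Fin N → v.adicCompletion F))) : (Fin N → v.adicCompletion F) → ℂ) x) ∂μX) *
        conj (((χv h : ℂˣ) : ℂ))‖ ∂dh =
      dh.real (localInt E c 1 J₁ v : Set (localPi E c 1 J₁ v)) * ‖C‖ * ((1 + r) / (1 - r)) := by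
  set f : localPi E c 1 J₁ v → ℂ := fun h =>
    (∫ x, ((𝓢.omegaLoc v (localCenter E c N J J₁ hJ₁ v h) (unitVec F (Fin N) v) :
          ↥(SchwartzBruhat (Fin N → v.adicCompletion F))) : (Fin N → v.adicCompletion F) → ℂ) x *
        conj (((unitVec F (Fin N) v : ↥(SchwartzBruhat (Fin N → v.adicCompletion F))) : (Fin N → v.adicCompletion F) → ℂ) x) ∂μX) *
      conj (((χv h : ℂˣ) : ℂ)) with hfdef
  -- `g = |f|` as a complex-valued function, right-`U(J₁)(𝒪_v)`-invariant
  set g : localPi E c 1 J₁ v → ℂ := fun h => ((‖f h‖ : ℝ) : ℂ) with hgdef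
  have hf : ∀ h : localPi E c 1 J₁ v, ∀ k ∈ localInt E c 1 J₁ v, f (h * k) = f h := fun h k hk =>
    𝓢.localFactor_unitVec_mul_of_mem J₁ hJ₁ v μX χv hfix hχK h hk
  have hg : ∀ h : localPi E c 1 J₁ v, ∀ k ∈ localInt E c 1 J₁ v, g (h * k) = g h := fun h k hk => by
    simp only [hgdef, hf h k hk]
  -- the values on the generators: `|f(z₀^m)| = |C| r^{|m|}`
  have hfz : ∀ m : ℤ, ‖f (z₀ ^ m)‖ = ‖C‖ * r ^ m.natAbs := by
    intro m
    simp only [hfdef]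
    rw [hcoef m, map_zpow, Units.val_zpow_eq_zpow_val, map_zpow₀, norm_mul, norm_mul, norm_mul, norm_zpow, norm_zpow,
      Complex.norm_conj, hχu, hu, one_zpow, mul_one, mul_one, norm_pow, Complex.norm_real, Real.norm_eq_abs,
      abs_of_nonneg hr0]
  have hgz : ∀ m : ℤ, g (z₀ ^ m) = ((‖C‖ * r ^ m.natAbs : ℝ) : ℂ) := fun m => by simp only [hgdef, hfz m]
  have hsum : Summable fun m : ℤ => ‖g (z₀ ^ m)‖ := by
    refine ((Li1992.summable_pow_natAbs hr0 hr1).mul_left ‖C‖).congr fun m => ?_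
    rw [hgz m, Complex.norm_real, Real.norm_eq_abs, abs_of_nonneg (mul_nonneg (norm_nonneg _) (pow_nonneg hr0 _))]
  obtain ⟨-, hS⟩ := Li1992.integrable_and_hasSum_integral_of_cosets dh (localInt E c 1 J₁ v) (isOpen_localInt E c 1 J₁ v)
    (isCompact_localInt E c 1 J₁ v).measure_lt_top.ne z₀ hcover hfree g hg hsum
  have hS' : HasSum (fun m : ℤ => (dh.real (localInt E c 1 J₁ v : Set (localPi E c 1 J₁ v)) : ℂ) * (((‖C‖ * r ^ m.natAbs : ℝ) : ℂ)))
      (∫ h, g h ∂dh) := hS.congr_fun fun m => by rw [hgz m]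
  -- the Tate-type sum `vol · |C| · Σ_m r^{|m|} = vol · |C| · (1 + r)/(1 − r)`
  have hgeo : HasSum (fun m : ℤ => (dh.real (localInt E c 1 J₁ v : Set (localPi E c 1 J₁ v)) : ℂ) * (((‖C‖ * r ^ m.natAbs : ℝ) : ℂ)))
      (((dh.real (localInt E c 1 J₁ v : Set (localPi E c 1 J₁ v)) * ‖C‖ * ((1 + r) / (1 - r)) : ℝ) : ℂ)) := by
    have h := Complex.hasSum_ofReal.2
      ((Li1992.hasSum_pow_natAbs hr0 hr1).mul_left (dh.real (localInt E c 1 J₁ v : Set (localPi E c 1 J₁ v)) * ‖C‖))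
    refine h.congr_fun fun m => ?_
    push_cast
    ring
  have hint : ∫ h, g h ∂dh = (((dh.real (localInt E c 1 J₁ v : Set (localPi E c 1 J₁ v)) * ‖C‖ * ((1 + r) / (1 - r)) : ℝ) : ℂ)) :=
    hS'.unique hgeo
  have h1 : ((∫ h, ‖f h‖ ∂dh : ℝ) : ℂ) = ∫ h, g h ∂dh := by
    simp only [hgdef]
    exact integral_complex_ofReal.symm
  exact Complex.ofReal_injective (h1.trans hint)

/-- **THE INTEGRAL OF THE NORM OF THE LOCAL INTEGRAND OF (27) WHERE THE WHOLE TORUS FIXES `1_{𝒪ᴺ}` AND `χ_v ≡ 1`** (the non-split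
unramified places, ★ `eventually_unitVec_fixed_and_localChar_eq_one_of_nonsplit`): the integrand is the constant `μ_X(𝒪_vᴺ) ≥ 0`, so
`∫_{U(J₁)(F_v)} |⟨ω_v(u·1) 1_{𝒪ᴺ}, 1_{𝒪ᴺ}⟩ conj χ_v(u)| du = dh(U(J₁)(F_v)) · μ_X(𝒪_vᴺ)`, for ANY measures.
[cite: Li1992, Thm 2.1 (27) p. 184; §5 p. 206] [cite: TateThesis1967, §3.2 Lemma 3.2.1] -/
theorem integral_norm_localFactor_unitVec_of_fixed (hm : MeasurableSet (integralBox F (Fin N) v))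
    (hfix : ∀ u : localPi E c 1 J₁ v, 𝓢.omegaLoc v (localCenter E c N J J₁ hJ₁ v u) (unitVec F (Fin N) v) = unitVec F (Fin N) v)
    (hχ : ∀ u : localPi E c 1 J₁ v, χv u = 1) :
    ∫ h, ‖(∫ x, ((𝓢.omegaLoc v (localCenter E c N J J₁ hJ₁ v h) (unitVec F (Fin N) v) :
            ↥(SchwartzBruhat (Fin N → v.adicCompletion F))) : (Fin N → v.adicCompletion F) → ℂ) x *
          conj (((unitVec F (Fin N) v : ↥(SchwartzBruhat (Fin N → v.adicCompletion F))) : (Fin N → v.adicCompletion F) → ℂ) x) ∂μX) *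
        conj (((χv h : ℂˣ) : ℂ))‖ ∂dh =
      dh.real Set.univ * μX.real (integralBox F (Fin N) v) := by
  have hconst : ∀ h : localPi E c 1 J₁ v,
      ‖(∫ x, ((𝓢.omegaLoc v (localCenter E c N J J₁ hJ₁ v h) (unitVec F (Fin N) v) :
            ↥(SchwartzBruhat (Fin N → v.adicCompletion F))) : (Fin N → v.adicCompletion F) → ℂ) x *
          conj (((unitVec F (Fin N) v : ↥(SchwartzBruhat (Fin N → v.adicCompletion F))) : (Fin N → v.adicCompletion F) → ℂ) x) ∂μX) *
        conj (((χv h : ℂˣ) : ℂ))‖ = μX.real (integralBox F (Fin N) v) := by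
    intro h
    rw [hfix h, hχ h, Units.val_one, map_one, mul_one, Li1992.integral_unitVec_mul_conj_unitVec F N v μX hm, Complex.norm_real,
      Real.norm_eq_abs, abs_of_nonneg measureReal_nonneg]
  simp_rw [hconst, integral_const, smul_eq_mul]

/-- … and the VALUE there is `dh(U(J₁)(F_v)) · μ_X(𝒪_vᴺ)` (★ `integral_coeff_mul_conj_eq_of_fixed` + ★ `integral_unitVec_mul_conj_unitVec`,
restated in the present binders). [cite: Li1992, Thm 2.1 (27) p. 184; §5 p. 206] -/
theorem integral_localFactor_unitVec_of_fixed' (hm : MeasurableSet (integralBox F (Fin N) v))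
    (hfix : ∀ u : localPi E c 1 J₁ v, 𝓢.omegaLoc v (localCenter E c N J J₁ hJ₁ v u) (unitVec F (Fin N) v) = unitVec F (Fin N) v)
    (hχ : ∀ u : localPi E c 1 J₁ v, χv u = 1) :
    ∫ h, (∫ x, ((𝓢.omegaLoc v (localCenter E c N J J₁ hJ₁ v h) (unitVec F (Fin N) v) :
            ↥(SchwartzBruhat (Fin N → v.adicCompletion F))) : (Fin N → v.adicCompletion F) → ℂ) x *
          conj (((unitVec F (Fin N) v : ↥(SchwartzBruhat (Fin N → v.adicCompletion F))) : (Fin N → v.adicCompletion F) → ℂ) x) ∂μX) *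
        conj (((χv h : ℂˣ) : ℂ)) ∂dh =
      (dh.real Set.univ : ℂ) * (μX.real (integralBox F (Fin N) v) : ℂ) := by
  rw [← Li1992.integral_unitVec_mul_conj_unitVec F N v μX hm]
  exact Li1992.integral_coeff_mul_conj_eq_of_fixed dh μX
    (show Representation ℂ (localPi E c 1 J₁ v) ↥(SchwartzBruhat (Fin N → v.adicCompletion F)) from
      (𝓢.omegaLoc v).comp (localCenter E c N J J₁ hJ₁ v))
    χv hχ (Φ := unitVec F (Fin N) v) (fun u => hfix u) (unitVec F (Fin N) v)

end Literature.NumberTheory.GelbartRogawski1991.UnitaryDualPair.LocalSplitting.FinLocalSplittings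

end
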